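import Summits.Ventures.HodgeRepro2.T6NAut2
import Summits.Ventures.HodgeRepro2.T6NAutToyN

/-!
# T6NAut2Toy — the v2 composition carrier on the toy: the seven binders of `periodInputN_of_mains₂`
are jointly satisfiable, parametrically in an admissible N2 datum

Cell pub-hodge-repro2, Tier 6 (README §10), seat t6-lead (gen 2). NON-VACUITY OF THE M2 v2
COMPOSITION (TARGET-T6 v0.4 §10.5(ii)(d)): the v1 toy `NAutToyN.toy` (T6NAutToyN: the eigenvector
period datum `toyNDatumN`, the toy N3 datum `N3Toy.toy`, the toy N5 data) is lifted to a v2 carrier by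
`NAut2.ofNAut` with an N2 datum `d2 : N2Datum F _ N3Toy.toy`. The N2 datum is the N2 OWNER's object
(t6-p5's T6N2Toy: `τ`, two sign elements, `u`, `Char := Unit`, admissible sets `Set.univ`, with
`Adm` from the Shimura display); here it is a PARAMETER — any N2 datum over the toy N3 datum that is
admissible (`hAdm : d2.Adm`) and admits every quadruple (`hAll : ∀ φ, d2.AdmData φ`) — so that
`exists_joint₂` is the carrier-level statement: for EVERY face setting `F` some period datum and some
v2 carrier satisfy the seven binders of `periodInputN_of_mains₂` jointly, N2's `M.AdmDatum` included.
The period datum is a phantom parameter of `N2Datum` (t6-p5's `_P`), so the owner's datum, given over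
one period datum, transports to the toy's by `N2Datum.reindex` (every field copied; `Adm` and
`AdmData` unchanged by `Iff.rfl`).

§8(d): uses an L-value-free non-vanishing device: NO.
-/

namespace Summit.Ventures.HodgeRepro2.T6

open scoped InnerProductSpace

variable {K : Type} [Field K] [NumberField K] [NumberField.IsCMField K]

namespace N2Datum

variable {F : FaceSetting K} {P₀ : NDatum F} {𝒟 : N3Datum}

/-- Re-indexing an N2 datum along another period datum: the period datum is a phantom parameter of
`N2Datum`, every field is copied. -/
def reindex (D : N2Datum F P₀ 𝒟) (P : NDatum F) : N2Datum F P 𝒟 where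
  τ := D.τ
  e₁₁₁ := D.e₁₁₁
  e₁₀₀ := D.e₁₀₀
  u := D.u
  Char := D.Char
  instCommGroupChar := D.instCommGroupChar
  χ₁₁₁ := D.χ₁₁₁
  χ₁₀₀ := D.χ₁₀₀
  admA := D.admA
  admB := D.admB
  admC := D.admC
  admD := D.admD

/-- Re-indexing preserves the datum-level admissibility. -/
theorem reindex_adm (D : N2Datum F P₀ 𝒟) (P : NDatum F) : (D.reindex P).Adm ↔ D.Adm := Iff.rfl

omit [NumberField.IsCMField K] in
/-- Re-indexing preserves the quadruple-level admissibility. -/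
theorem reindex_admData (D : N2Datum F P₀ 𝒟) (P : NDatum F) (φ : 𝒟.A.Sa × 𝒟.A.Sb × 𝒟.B.Sa × 𝒟.B.Sb) :
    (D.reindex P).AdmData φ ↔ D.AdmData φ := Iff.rfl

end N2Datum

namespace NAut2Toy

open NAutToyN

/-- The v2 toy carrier: the v1 toy `NAutToyN.toy` with the (re-indexed) N2 datum `d2`. -/
noncomputable def toy (F : FaceSetting K) {σ : K →+* ℂ} {w : KC K} (hw : w ∈ eigenLineK K σ)
    (hw0 : w ≠ 0) {P₀ : NDatum F} (d2 : N2Datum F P₀ N3Toy.toy) :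
    NAut2 F (toyNDatumN F hw hw0) :=
  NAut2.ofNAut (NAutToyN.toy F hw hw0) (d2.reindex _)

/-- JOINT CONSISTENCY OF THE v2 COMPOSITION'S HYPOTHESES ON THE TOY, parametrically in an admissible
N2 datum over the toy N3 datum with every quadruple admissible: for every face setting `F` some period
datum and some v2 carrier satisfy the seven binders of `periodInputN_of_mains₂` jointly. -/
theorem exists_joint₂ (F : FaceSetting K) {P₀ : NDatum F} (d2 : N2Datum F P₀ N3Toy.toy)
    (hAdm : d2.Adm) (hAll : ∀ φ, d2.AdmData φ) :
    ∃ (P : NDatum F) (M : NAut2 F P),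
      (∀ c, P.AdmChoice c → M.pairing c ≠ 0 → P.I P.τ₁ c ≠ 0) ∧ M.AdmDatum ∧
      (M.iA → M.iiA → M.ellA) ∧ (M.iB → M.iiB → M.ellB) ∧
      (M.ellA → M.ellB → ∃ (φa : M.d3.A.Sa) (φb : M.d3.A.Sb) (φc : M.d3.B.Sa) (φd : M.d3.B.Sb),
        M.AdmData (φa, φb, φc, φd) ∧ ⟪M.d3.B.F φc φd, M.d3.A.F φa φb⟫_ℂ ≠ 0) ∧
      (M.iA ∧ M.iB) ∧ M.N5 := by
  obtain ⟨σ, w, hw, hw0⟩ := ToyN.exists_eigenvector_KC K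
  refine ⟨toyNDatumN F hw hw0, toy F hw hw0 d2, fun c _ _ => I_ne_zero F hw hw0 c,
    (N2Datum.reindex_adm d2 _).2 hAdm, fun _ _ => N3Toy.toy_N3A, fun _ _ => N3Toy.toy_N3A, ?_,
    ⟨N3Toy.toy_hypI, N3Toy.toy_hypI⟩, N5Toy.toyData_N5⟩
  intro _ _
  obtain ⟨c, -, hne⟩ :=
    (NAutToyN.toy F hw hw0).exists_choice_of_pairing_ne_zero N3Toy.toy_N3iso
  exact ⟨((NAutToyN.toy F hw hw0).data c).1, ((NAutToyN.toy F hw hw0).data c).2.1,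
    ((NAutToyN.toy F hw hw0).data c).2.2.1, ((NAutToyN.toy F hw hw0).data c).2.2.2,
    (N2Datum.reindex_admData d2 _ _).2 (hAll _), hne⟩

/-- The v2 composition's conclusion on the toy is the TRUE statement `Hyp.PeriodN (toyN F hw0)`: the
toy carrier's shadow at every choice is `ToyN.toyN F hw0`, whose period input holds outright
(`ToyN.periodN_toyN`) — so the seven binders are consistent AND their conclusion is not vacuous. -/
theorem toy_periodInputN_of_mains₂ (F : FaceSetting K) {σ : K →+* ℂ} {w : KC K}
    (hw : w ∈ eigenLineK K σ) (hw0 : w ≠ 0) {P₀ : NDatum F} (d2 : N2Datum F P₀ N3Toy.toy)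
    (hAdm : d2.Adm) (hAll : ∀ φ, d2.AdmData φ) :
    ∃ c, (toyNDatumN F hw hw0).AdmChoice c ∧ Hyp.PeriodN ((toyNDatumN F hw hw0).shadow c) := by
  refine periodInputN_of_mains₂ (toyNDatumN F hw hw0) (toy F hw hw0 d2)
    (fun c _ _ => I_ne_zero F hw hw0 c) ((N2Datum.reindex_adm d2 _).2 hAdm)
    (fun _ _ => N3Toy.toy_N3A) (fun _ _ => N3Toy.toy_N3A) ?_ ⟨N3Toy.toy_hypI, N3Toy.toy_hypI⟩
    N5Toy.toyData_N5
  intro _ _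
  obtain ⟨c, -, hne⟩ :=
    (NAutToyN.toy F hw hw0).exists_choice_of_pairing_ne_zero N3Toy.toy_N3iso
  exact ⟨((NAutToyN.toy F hw hw0).data c).1, ((NAutToyN.toy F hw hw0).data c).2.1,
    ((NAutToyN.toy F hw hw0).data c).2.2.1, ((NAutToyN.toy F hw hw0).data c).2.2.2,
    (N2Datum.reindex_admData d2 _ _).2 (hAll _), hne⟩

end NAut2Toy

end Summit.Ventures.HodgeRepro2.T6
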